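import Mathlib
import Summits.Ventures.PercRepro2.Defs
import Summits.Ventures.PercRepro2.Independence
import Summits.Ventures.PercRepro2.Harris
import Summits.Ventures.PercRepro2.Graph
import Summits.Ventures.PercRepro2.Exploration
import Summits.Ventures.PercRepro2.Events
import Summits.Ventures.PercRepro2.FourFunctions
import Summits.Ventures.PercRepro2.Induced
import Summits.Ventures.PercRepro2.Frontier
import Summits.Ventures.PercRepro2.ObsIndependence
import Summits.Ventures.PercRepro2.BHK
import Summits.Ventures.PercRepro2.BHKEvents
import Summits.Ventures.PercRepro2.MultiSource
import Summits.Ventures.PercRepro2.OrderPreservation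
import Summits.Ventures.PercRepro2.SeedSet
import Summits.Ventures.PercRepro2.MultiSourceFun
import Summits.Ventures.PercRepro2.CrossRootT
import Summits.Ventures.PercRepro2.VdBKahn
import Summits.Ventures.PercRepro2.HullDefs
import Summits.Ventures.PercRepro2.CCTRootEdge
import Summits.Ventures.PercRepro2.R1Rung
import Summits.Ventures.PercRepro2.CC2Rung
import Summits.Ventures.PercRepro2.PASubDefs
import Summits.Ventures.PercRepro2.PASub
import Summits.Ventures.PercRepro2.HalfN
import Summits.Ventures.PercRepro2.PAK
import Summits.Ventures.PercRepro2.CCTLin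
import Summits.Ventures.PercRepro2.BasePrime
import Summits.Ventures.PercRepro2.BasePendant

/-!
# (L1-K) at an unmarked pendant edge is a theorem: it is (PA-K) (blind cell PercRepro2, typer-1;
lead g11 14:08:43Z "(L1-K) ↦ (RB-T) … `L1K` at a pendant edge — worth the identity lemma
`L1K_pendant_iff`"; ASSIGNMENTS v11.12 typer item (2))

Let `e = {l, u}` be a pendant edge whose leaf `l` carries no other edge and is unmarked
(`l ∉ {s, a, b} ∪ T`). Pinning `e` then changes no connection among the other vertices
(`conn_update_leaf_iff`), so the `e`-closed masses of `CCTLin.L1K` equal the `e`-open ones: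
`P₀ = P₁ = Σ λ₁`, `F₀ᵃ = F₁ᵃ = Σ x₁ λ₁`, `F₀ᵇ = F₁ᵇ = Σ y₁ λ₁` (`massP_update_zero_eq_one`,
`massF_update_zero_eq_one`, `sum_lambda_eq`, `sum_x_lambda_eq`). The cleared (L1-K) expression
collapses to

  `P₀² Σx₁y₁λ₁ − P₀(F₀ᵃ Σy₁λ₁ + F₀ᵇ Σx₁λ₁) + F₀ᵃF₀ᵇ Σλ₁ = Σλ₁ · (Σx₁y₁λ₁ · Σλ₁ − Σx₁λ₁ · Σy₁λ₁)`

(`L1K_pendant_expr_eq`), i.e. `P(R_T) · Cov_{λ}(x, y)` — the lead's (RB-T)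
`P(R_T) Σ_{W∌s} x(W)y(W)λ(W) ≥ (Σxλ)(Σyλ)` — which is exactly `PAK.paK`. Hence

* **`L1K_pendant`**: (L1-K) holds at every unmarked pendant edge (all `n`, all weights);
* **`L1K_pendant_iff`**: with `P(R_T) > 0`, (L1-K) at such an edge is *equivalent* to (RB-T).

Consequence (with `CCTLin.CC2_of_L1K`): the first rung (CC-T) holds at every unmarked pendant edge.
-/

namespace Summit.Ventures.PercRepro2

namespace L1KPendant

open PASub HalfN TwoSetRung CCTLin

open scoped Classical

variable {V : Type*} {E : Type*} [Fintype E] [DecidableEq E] [Fintype V] [DecidableEq V]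
  {R : Type*} [Field R] [LinearOrder R] [IsStrictOrderedRing R]

variable (p : E → R) (ends : E → Sym2 V) (e : E) (s : V) (T : Finset V)

/-! ## The `e`-open masses as partition sums over `{K⁺ = W}` -/

omit [DecidableEq V] [LinearOrder R] [IsStrictOrderedRing R] in
/-- `Σ_{W∌s} x₁(W) λ₁(W) = F₁ᵃ = P_{p[e↦1]}(R_T ∩ {s ↔ a})`. -/
lemma sum_x_lambda_eq (a : V) :
    (∑ W : Set V, if s ∉ W then
        prob p (XdelP ends e s W a) * prob p (KEvent ends e T W) else 0) =
      massF (Function.update p e 1) ends s {a} T := by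
  rw [massF_update_one_eq, prob_inter_Rplus_eq_sum]
  refine Finset.sum_congr rfl fun W _ => ?_
  by_cases hs : s ∉ W
  · rw [if_pos hs, if_pos hs, ← prob_XdelP_inter_KEvent]
    congr 1
    ext ω
    simp only [Set.mem_inter_iff]
    constructor
    · rintro ⟨hx, hK⟩; exact ⟨(mem_Xplus_iff_of_K ends e s T hK hs a).2 hx, hK⟩
    · rintro ⟨hx, hK⟩; exact ⟨(mem_Xplus_iff_of_K ends e s T hK hs a).1 hx, hK⟩
  · rw [if_neg hs, if_neg hs]

omit [DecidableEq V] [LinearOrder R] [IsStrictOrderedRing R] in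
/-- `Σ_{W∌s} λ₁(W) = P₁ = P_{p[e↦1]}(R_T)`. -/
lemma sum_lambda_eq :
    (∑ W : Set V, if s ∉ W then prob p (KEvent ends e T W) else 0) =
      massP (Function.update p e 1) ends s T := by
  rw [massP_update_one_eq]
  have h := prob_inter_Rplus_eq_sum p ends e s T Set.univ
  rw [Set.univ_inter] at h
  rw [h]
  refine Finset.sum_congr rfl fun W _ => ?_
  rw [Set.univ_inter]

/-! ## Pinning an unmarked pendant edge does not move the masses -/

omit [Fintype V] [DecidableEq V] [LinearOrder R] [IsStrictOrderedRing R] in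
/-- `P₀ = P₁` at a pendant edge `e = {l, u}` whose leaf `l` is neither the root nor in `T`. -/
lemma massP_update_zero_eq_one {l u : V} (hf : ends e = s(l, u))
    (hleaf : ∀ e', l ∈ ends e' → e' = e) (hlu : l ≠ u) (hls : l ≠ s) (hlT : l ∉ T) :
    massP (Function.update p e 0) ends s T = massP (Function.update p e 1) ends s T := by
  unfold massP
  rw [CCT.prob_update_zero_eq, CCT.prob_update_one_eq]
  congr 1
  ext ω
  simp only [Set.mem_setOf_eq, avoidAll]
  have key : ∀ (c : Bool) (x : V), x ∈ T →
      (Conn ends (Function.update ω e c) s x ↔ Conn ends ω s x) :=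
    fun c x hx => conn_update_leaf_iff hf hleaf hlu c hls.symm (fun hxl => hlT (hxl ▸ hx))
  constructor
  · intro h x hx
    rw [key true x hx, ← key false x hx]
    exact h x hx
  · intro h x hx
    rw [key false x hx, ← key true x hx]
    exact h x hx

omit [Fintype V] [DecidableEq V] [LinearOrder R] [IsStrictOrderedRing R] in
/-- `F₀ᵃ = F₁ᵃ` at a pendant edge `e = {l, u}` whose leaf `l` is not `s`, not `a`, not in `T`. -/
lemma massF_update_zero_eq_one {l u : V} (hf : ends e = s(l, u))
    (hleaf : ∀ e', l ∈ ends e' → e' = e) (hlu : l ≠ u) (hls : l ≠ s) (hlT : l ∉ T) {a : V}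
    (hla : l ≠ a) :
    massF (Function.update p e 0) ends s {a} T = massF (Function.update p e 1) ends s {a} T := by
  unfold massF
  rw [CCT.prob_update_zero_eq, CCT.prob_update_one_eq]
  congr 1
  ext ω
  simp only [Set.mem_setOf_eq, Set.mem_inter_iff, avoidAll, connAll, Finset.mem_singleton,
    forall_eq]
  have key : ∀ (c : Bool) (x : V), x ≠ l →
      (Conn ends (Function.update ω e c) s x ↔ Conn ends ω s x) :=
    fun c x hx => conn_update_leaf_iff hf hleaf hlu c hls.symm hx
  constructor
  · rintro ⟨h, ha⟩
    refine ⟨fun x hx => ?_, ?_⟩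
    · rw [key true x (fun hxl => hlT (hxl ▸ hx)), ← key false x (fun hxl => hlT (hxl ▸ hx))]
      exact h x hx
    · rw [key true a hla.symm, ← key false a hla.symm]
      exact ha
  · rintro ⟨h, ha⟩
    refine ⟨fun x hx => ?_, ?_⟩
    · rw [key false x (fun hxl => hlT (hxl ▸ hx)), ← key true x (fun hxl => hlT (hxl ▸ hx))]
      exact h x hx
    · rw [key false a hla.symm, ← key true a hla.symm]
      exact ha

/-! ## (L1-K) at an unmarked pendant edge -/

omit [DecidableEq V] [LinearOrder R] [IsStrictOrderedRing R] in
/-- The cleared (L1-K) expression at an unmarked pendant edge equals `Σλ₁ · (Σx₁y₁λ₁·Σλ₁ − Σx₁λ₁·Σy₁λ₁)`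
= `P(R_T) · Cov_{λ₁}(x₁, y₁)`, the lead's (RB-T) form. -/
theorem L1K_pendant_expr_eq {l u : V} (hf : ends e = s(l, u))
    (hleaf : ∀ e', l ∈ ends e' → e' = e) (hlu : l ≠ u) (hls : l ≠ s) (hlT : l ∉ T) {a b : V}
    (hla : l ≠ a) (hlb : l ≠ b) :
    massP (Function.update p e 0) ends s T ^ 2 *
        (∑ W : Set V, if s ∉ W then
          prob p (XdelP ends e s W a) * prob p (XdelP ends e s W b) * prob p (KEvent ends e T W)
          else 0) -
      massP (Function.update p e 0) ends s T *
        (massF (Function.update p e 0) ends s {a} T *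
            (∑ W : Set V, if s ∉ W then prob p (XdelP ends e s W b) * prob p (KEvent ends e T W)
              else 0) +
          massF (Function.update p e 0) ends s {b} T *
            (∑ W : Set V, if s ∉ W then prob p (XdelP ends e s W a) * prob p (KEvent ends e T W)
              else 0)) +
      massF (Function.update p e 0) ends s {a} T * massF (Function.update p e 0) ends s {b} T *
        (∑ W : Set V, if s ∉ W then prob p (KEvent ends e T W) else 0) =
    (∑ W : Set V, if s ∉ W then prob p (KEvent ends e T W) else 0) *
      ((∑ W : Set V, if s ∉ W then
          prob p (XdelP ends e s W a) * prob p (XdelP ends e s W b) * prob p (KEvent ends e T W)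
          else 0) *
        (∑ W : Set V, if s ∉ W then prob p (KEvent ends e T W) else 0) -
      (∑ W : Set V, if s ∉ W then prob p (XdelP ends e s W a) * prob p (KEvent ends e T W)
          else 0) *
        (∑ W : Set V, if s ∉ W then prob p (XdelP ends e s W b) * prob p (KEvent ends e T W)
          else 0)) := by
  rw [massP_update_zero_eq_one p ends e s T hf hleaf hlu hls hlT,
    massF_update_zero_eq_one p ends e s T hf hleaf hlu hls hlT hla,
    massF_update_zero_eq_one p ends e s T hf hleaf hlu hls hlT hlb,
    ← sum_lambda_eq, ← sum_x_lambda_eq p ends e s T a, ← sum_x_lambda_eq p ends e s T b]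
  ring

/-- **(L1-K) holds at every unmarked pendant edge** (`e = {l, u}`, `l` a leaf with
`l ∉ {s, a, b} ∪ T`): the cleared expression is `Σλ₁ · (Σλ₁·Σx₁y₁λ₁ − Σx₁λ₁·Σy₁λ₁) ≥ 0` by
`PAK.paK` (BHK + decreasing functionals). With `CCTLin.CC2_of_L1K` this gives (CC-T) there. -/
theorem L1K_pendant (hp : IsProbVec p) {l u : V} (hf : ends e = s(l, u))
    (hleaf : ∀ e', l ∈ ends e' → e' = e) (hlu : l ≠ u) (hls : l ≠ s) (hlT : l ∉ T) {a b : V}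
    (hla : l ≠ a) (hlb : l ≠ b) : L1K p ends e s T a b := by
  unfold L1K
  rw [L1K_pendant_expr_eq p ends e s T hf hleaf hlu hls hlT hla hlb]
  have hS1 : 0 ≤ ∑ W : Set V, if s ∉ W then prob p (KEvent ends e T W) else 0 :=
    Finset.sum_nonneg fun W _ => by
      split_ifs <;> first | exact prob_nonneg hp _ | exact le_rfl
  exact mul_nonneg hS1 (sub_nonneg.2 (PAK.paK p ends e s T hp a b))

omit [DecidableEq V] in
/-- **`L1K_pendant_iff`**: at an unmarked pendant edge with `P(R_T) = Σλ₁ > 0`, (L1-K) is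
*equivalent* to the lead's (RB-T) `(Σx₁λ₁)(Σy₁λ₁) ≤ (Σx₁y₁λ₁)(Σλ₁)` (= `PAK.paK`). -/
theorem L1K_pendant_iff {l u : V} (hf : ends e = s(l, u))
    (hleaf : ∀ e', l ∈ ends e' → e' = e) (hlu : l ≠ u) (hls : l ≠ s) (hlT : l ∉ T) {a b : V}
    (hla : l ≠ a) (hlb : l ≠ b)
    (hpos : 0 < ∑ W : Set V, if s ∉ W then prob p (KEvent ends e T W) else 0) :
    L1K p ends e s T a b ↔
      (∑ W : Set V, if s ∉ W then prob p (XdelP ends e s W a) * prob p (KEvent ends e T W)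
          else 0) *
        (∑ W : Set V, if s ∉ W then prob p (XdelP ends e s W b) * prob p (KEvent ends e T W)
          else 0) ≤
      (∑ W : Set V, if s ∉ W then
          prob p (XdelP ends e s W a) * prob p (XdelP ends e s W b) * prob p (KEvent ends e T W)
          else 0) *
        (∑ W : Set V, if s ∉ W then prob p (KEvent ends e T W) else 0) := by
  unfold L1K
  rw [L1K_pendant_expr_eq p ends e s T hf hleaf hlu hls hlT hla hlb]
  constructor
  · intro h
    exact sub_nonneg.1 (nonneg_of_mul_nonneg_right h hpos)
  · intro h
    exact mul_nonneg hpos.le (sub_nonneg.2 h)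

/-- Corollary: the first rung (CC-T) `TwoSetRung.CC2 p ends e s {a} {b} T T` holds at every
unmarked pendant edge. -/
theorem CC2_pendant (hp : IsProbVec p) {l u : V} (hf : ends e = s(l, u))
    (hleaf : ∀ e', l ∈ ends e' → e' = e) (hlu : l ≠ u) (hls : l ≠ s) (hlT : l ∉ T) {a b : V}
    (hla : l ≠ a) (hlb : l ≠ b) : CC2 p ends e s {a} {b} T T :=
  CC2_of_L1K p ends e s T hp a b (L1K_pendant p ends e s T hp hf hleaf hlu hls hlT hla hlb)

end L1KPendant

end Summit.Ventures.PercRepro2
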